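import Summits.QuantumFields.BalabanUV.Beta.GAN24.CapacitanceEndpointBlocks
import Summits.QuantumFields.BalabanUV.Beta.GAN24.CapacitanceClosedFormAlias

/-!
# `BalabanUV.Beta.GAN24.CapacitanceEndpoint` — binder row G-an2-4 / (CONV-C), road P1-fibre, leaf P1-L08 of `SKELETON-P1.md` (the crux A4 `cap_lower`, ASSEMBLY), part 2/2:
# N-UNIFORM BLOCKWISE BOUNDS OF THE INVERSE CAPACITANCE MATRIX `(cap N p)⁻¹` at real Brillouin momentum `p ∈ [−π, π]^D ∖ {0}`

NOT IN PRINT; OUR PROOF ATTEMPT.  HONEST FRAMING (cell contract, verbatim): «discharging `BetaPertH` makes Bałaban's UV stability UNCONDITIONAL — a real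
constructive-QFT result; it is NOT the continuum limit and NOT the Clay problem.»  HONEST DEPENDENCY (verbatim): «continuum YM on T⁴ ⇐ BetaPertH ∧ nine spine
estimates (0/9 proved); BetaPertH ⇐ (D1) ∧ (D4) ∧ CAP+tail; G-an2-4 gates asym, D1 and NE2/3/4.»  [folklore] assembly of the cell's landed finite-dimensional
algebra (`GAN24/CapacitanceClosedForm(+Matrix,+Alias)`, leaf-02; `GAN24/AliasObjects`, leaf-14; `GAN24/CapacitanceSolve`, leaf-15) with its landed explicit
real analysis (`GAN24/CapacitanceScalarBounds(+Border,+Dictionary)`, leaf-12) and part 1/2 `GAN24/CapacitanceEndpointBlocks` — every input BY NAME; no cited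
fact, no wall binder, no `def … : Prop` hypothesis, no cancellation used, no `def`.  NOT summit progress: it discharges NOTHING of (CONV-C)'s K-slot
`GAN24.CombesThomas.ConvCK 3 Lc` by itself (rows L09/L10/L11/L12 are downstream); 0 wall binders instantiated; NOT `BetaPertH`, NOT continuum, NOT Clay.

## What is proved (every `D`, every `N ≥ 1`, every `q ∈ [−π, π]^D` with `q ≠ 0`, `p = ofRealVec q`; `|q|² = momSq q`; constants `cPP/cPc/ccc` of part 1/2)
* §4 For ANY abstract fibre `F : CapacitanceSolve.Fibre D ι` with the telescoping identities (T1)/(T2) of `CapacitanceClosedForm` for `δ = dhat p`, `δ' = dflat p`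
  and whose closed-form scalars ARE the real sums (`aDiag F κ = ↑capDiag N q κ`, `sigma F = ↑capBorder N q` as HYPOTHESES — equalities of data, never a `Prop`
  fact): the three non-vanishings hold (`nonvanishing`), the capacitance system has exactly the closed-form solution (`capSolves_iff_closedForm_real`) and
  `‖φ κ‖ ≤ cPP·|q|²/N^{D+4}·Σ_l‖Q_l‖ + cPc·|q|²√|q|²/N^{D+4}·‖R‖`, `‖c‖ ≤ cPc·|q|²√|q|²/N^{D+4}·Σ_l‖Q_l‖ + ccc·|q|⁴/N^{D+4}·‖R‖` (`Q = q′ − srcQ`, `R = −ρ − srcM`).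
* §5 **THE ENDPOINT ON THE CONCRETE MATRIX** `AliasObjects.cap N p` of typer row P1-T00 (leaf-02's `cap_inv_inl_inl/…`, `isUnit_cap`, `phiSol_eq`/`cSol_eq` and
  leaf-12's dictionary `aDiag_fibreAl`/`sigma_fibreAl`/`LAl_ofRealVec_ne_zero` BY NAME; the three non-vanishings discharged by positivity): UNCONDITIONALLY at
  every real `q ≠ 0` and every `N ≥ 1`, **`IsUnit (cap N p)`** (`isUnit_cap_ofRealVec`; T00's `hdet` binder `isUnit_cap_det_ofRealVec`);
  **`‖(cap N p)⁻¹ (inl κ) (inl l)‖ ≤ cPP D·|q|²/N^{D+4}`**, **`‖(cap N p)⁻¹ (inl κ) (inr ())‖, ‖(cap N p)⁻¹ (inr ()) (inl l)‖ ≤ cPc D·|q|²√|q|²/N^{D+4}`**,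
  **`‖(cap N p)⁻¹ (inr ()) (inr ())‖ ≤ ccc D·|q|⁴/N^{D+4}`** — `SKELETON-P1.md` A4′(iii), N-uniform, no cancellation; T00's closed-form pair `(phiSol, cSol)`
  SOLVES the capacitance system (`capSolves_phiSol_cSol`) and `(Ahat, muhat, phiSol, cSol)` the ARROW system (`arrowSolves_ofRealVec`), with
  `‖phiSol κ‖ ≤ cPP·|q|²/N^{D+4}·Σ_l‖r_φ l‖ + cPc·|q|²√|q|²/N^{D+4}·‖r_c‖`, `‖cSol‖ ≤ cPc·|q|²√|q|²/N^{D+4}·Σ_l‖r_φ l‖ + ccc·|q|⁴/N^{D+4}·‖r_c‖`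
  (`r_φ = srcPhi`, `r_c = srcC`).

Unit `b2b-balaban-gan24-formalise-leaf-20` (G-an2-4 formalisation swarm, leaf prover 20), 2026-08-19.  Value = kernel assembly leaf (the crux row's endpoint in
closed-form currency) toward the K-slot route P1, NOT summit progress.
-/

noncomputable section

open Complex Finset
open scoped BigOperators Real

namespace Summit.QuantumFields.BalabanUV.Beta.GAN24.CapacitanceEndpoint

open Literature.Probability.LatticeModels (TorusSite)
open Literature.MathematicalPhysics.QuantumFieldTheory.Balaban1983to89.B4Strip (ofRealVec)
open Literature.MathematicalPhysics.QuantumFieldTheory.King1986 (momSq momSq_nonneg)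
open FibreSymbols (dhat dflat)
open FibreBlockSolve (dot)
open CapacitanceSolve (Fibre CapSolves ArrowSolves srcQ srcM)
open CapacitanceClosedForm (hSum invPP invPc invcP invcc phiCF cCF aDiag sigma)
open CapacitanceScalarBounds (capDiag capDiag_pos momSq_pos)
open CapacitanceScalarBoundsBorder (capBorder capH capBorder_pos capH_pos)
open CapacitanceScalarDictionary (LAl_ofRealVec_ne_zero)
open AliasObjects (LAl fibreAl cap capSol phiSol cSol srcPhi srcC Ahat muhat)

variable {D : ℕ}
open CapacitanceEndpointBlocks (cPP cPc ccc hSum_capDiag_eq norm_phiCF_le norm_cCF_le norm_invPP_le norm_invPc_le norm_invcP_le norm_invcc_le)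

/-! ## §4 Packaged: the capacitance solution of ANY fibre whose closed-form scalars are the real sums -/

section fibre
variable {ι : Type*} [Fintype ι] (F : Fibre D ι) {N : ℕ} [NeZero N] {q : Fin D → ℝ}

/-- [folklore] Under the scalar identifications the three NON-VANISHINGS of `CapacitanceClosedForm` hold on the punctured zone:
`aDiag F κ ≠ 0`, `sigma F ≠ 0`, `hSum (aDiag F) (dhat p) (dflat p) ≠ 0` (positivity of `capDiag`, `capBorder`, `capH`, leaf-12). -/
theorem nonvanishing (hN : 1 ≤ N) (hq : ∀ i, |q i| ≤ π) (hq0 : q ≠ 0)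
    (ha : ∀ κ, aDiag F κ = (capDiag N q κ : ℂ)) (hσ : sigma F = (capBorder N q : ℂ)) :
    (∀ κ, aDiag F κ ≠ 0) ∧ sigma F ≠ 0 ∧ hSum (aDiag F) (dhat (ofRealVec q)) (dflat (ofRealVec q)) ≠ 0 := by
  have haF : aDiag F = fun κ => (capDiag N q κ : ℂ) := funext ha
  refine ⟨fun κ => ?_, ?_, ?_⟩
  · rw [ha κ]; exact Complex.ofReal_ne_zero.2 (capDiag_pos hN hq hq0 κ).ne'
  · rw [hσ]; exact Complex.ofReal_ne_zero.2 (capBorder_pos hN hq hq0).ne'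
  · rw [haF, hSum_capDiag_eq]; exact Complex.ofReal_ne_zero.2 (capH_pos hN hq hq0).ne'

/-- **CLOSED-FORM SOLUTION AT REAL MOMENTUM** [folklore]: for a fibre with (T1)/(T2) for `δ = dhat p`, `δ' = dflat p` (`p = ofRealVec q`) and the scalar
identifications, `CapSolves F f γ ρ q' φ c ↔ (φ, c) =` the closed form at the real data (`Q = q' − srcQ`, `R = −ρ − srcM`) — existence AND uniqueness on
`[−π, π]^D ∖ {0}`, every `N ≥ 1` (leaf-02's `capSolves_iff_closedForm` with its three non-vanishings discharged). -/
theorem capSolves_iff_closedForm_real (hN : 1 ≤ N) (hq : ∀ i, |q i| ≤ π) (hq0 : q ≠ 0)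
    (hT1 : ∀ m κ, F.wQ m κ * F.dd m κ = F.wM m * dhat (ofRealVec q) κ) (hT2 : ∀ m κ, F.db m κ * F.wE m κ = F.wG m * dflat (ofRealVec q) κ)
    (ha : ∀ κ, aDiag F κ = (capDiag N q κ : ℂ)) (hσ : sigma F = (capBorder N q : ℂ))
    (f : ι → Fin D → ℂ) (γ : ι → ℂ) (ρ : ℂ) (q' : Fin D → ℂ) (φ : Fin D → ℂ) (c : ℂ) :
    CapSolves F f γ ρ q' φ c ↔
      (φ = phiCF (fun κ => (capDiag N q κ : ℂ)) (dhat (ofRealVec q)) (dflat (ofRealVec q)) (capBorder N q : ℂ)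
              (fun κ => q' κ - srcQ F f γ κ) (-ρ - srcM F f)
        ∧ c = cCF (fun κ => (capDiag N q κ : ℂ)) (dhat (ofRealVec q)) (dflat (ofRealVec q)) (capBorder N q : ℂ)
              (fun κ => q' κ - srcQ F f γ κ) (-ρ - srcM F f)) := by
  obtain ⟨ha0, hσ0, hh0⟩ := nonvanishing F hN hq hq0 ha hσ
  have h := CapacitanceClosedForm.capSolves_iff_closedForm F _ _ hT1 hT2 ha0 hσ0 hh0 f γ ρ q' φ c
  rw [funext ha, hσ] at h
  exact h

/-- **N-UNIFORM BOUND OF THE MULTIPLIER BLOCK `φ`** of the capacitance solution of such a fibre [folklore]: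
`‖φ κ‖ ≤ cPP·|q|²/N^{D+4} · Σ_l ‖Q_l‖ + cPc·|q|²√|q|²/N^{D+4} · ‖R‖`. -/
theorem norm_phi_le (hN : 1 ≤ N) (hq : ∀ i, |q i| ≤ π) (hq0 : q ≠ 0)
    (hT1 : ∀ m κ, F.wQ m κ * F.dd m κ = F.wM m * dhat (ofRealVec q) κ) (hT2 : ∀ m κ, F.db m κ * F.wE m κ = F.wG m * dflat (ofRealVec q) κ)
    (ha : ∀ κ, aDiag F κ = (capDiag N q κ : ℂ)) (hσ : sigma F = (capBorder N q : ℂ))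
    {f : ι → Fin D → ℂ} {γ : ι → ℂ} {ρ : ℂ} {q' : Fin D → ℂ} {φ : Fin D → ℂ} {c : ℂ} (hcap : CapSolves F f γ ρ q' φ c) (κ : Fin D) :
    ‖φ κ‖ ≤ cPP D * momSq q / (N : ℝ) ^ (D + 4) * ∑ l, ‖q' l - srcQ F f γ l‖
      + cPc D * (momSq q * Real.sqrt (momSq q)) / (N : ℝ) ^ (D + 4) * ‖-ρ - srcM F f‖ := by
  obtain ⟨hφ, -⟩ := (capSolves_iff_closedForm_real F hN hq hq0 hT1 hT2 ha hσ f γ ρ q' φ c).1 hcap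
  rw [hφ]
  exact norm_phiCF_le hN hq hq0 _ _ κ

/-- **N-UNIFORM BOUND OF THE GAUGE CONSTANT `c`** of the capacitance solution of such a fibre [folklore] (no cancellation):
`‖c‖ ≤ cPc·|q|²√|q|²/N^{D+4} · Σ_l ‖Q_l‖ + ccc·|q|⁴/N^{D+4} · ‖R‖`. -/
theorem norm_c_le (hN : 1 ≤ N) (hq : ∀ i, |q i| ≤ π) (hq0 : q ≠ 0)
    (hT1 : ∀ m κ, F.wQ m κ * F.dd m κ = F.wM m * dhat (ofRealVec q) κ) (hT2 : ∀ m κ, F.db m κ * F.wE m κ = F.wG m * dflat (ofRealVec q) κ)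
    (ha : ∀ κ, aDiag F κ = (capDiag N q κ : ℂ)) (hσ : sigma F = (capBorder N q : ℂ))
    {f : ι → Fin D → ℂ} {γ : ι → ℂ} {ρ : ℂ} {q' : Fin D → ℂ} {φ : Fin D → ℂ} {c : ℂ} (hcap : CapSolves F f γ ρ q' φ c) :
    ‖c‖ ≤ cPc D * (momSq q * Real.sqrt (momSq q)) / (N : ℝ) ^ (D + 4) * ∑ l, ‖q' l - srcQ F f γ l‖
      + ccc D * momSq q ^ 2 / (N : ℝ) ^ (D + 4) * ‖-ρ - srcM F f‖ := by
  obtain ⟨-, hc⟩ := (capSolves_iff_closedForm_real F hN hq hq0 hT1 hT2 ha hσ f γ ρ q' φ c).1 hcap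
  rw [hc]
  exact norm_cCF_le hN hq hq0 _ _

end fibre

/-! ## §5 THE ENDPOINT: the concrete capacitance matrix `AliasObjects.cap N p` of typer row P1-T00 at real momentum -/

section endpoint
variable {N : ℕ} [NeZero N] {q : Fin D → ℝ}

/-- [folklore] The closed-form scalars of the alias fibre ARE the real sums, as functions (leaf-12's `aDiag_fibreAl` under `funext`). -/
theorem aDiag_fibreAl_eq (hN : 1 ≤ N) (hq : ∀ i, |q i| ≤ π) (hq0 : q ≠ 0) :
    aDiag (fibreAl N (ofRealVec q) (LAl_ofRealVec_ne_zero hN hq hq0)) = fun κ => (capDiag N q κ : ℂ) :=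
  funext fun κ => CapacitanceScalarDictionary.aDiag_fibreAl q _ κ

/-- [folklore] **THE THREE NON-VANISHINGS FOR THE ALIAS FIBRE**, discharged at every real `q ∈ [−π, π]^D ∖ {0}`, `N ≥ 1`. -/
theorem nonvanishing_fibreAl (hN : 1 ≤ N) (hq : ∀ i, |q i| ≤ π) (hq0 : q ≠ 0) :
    (∀ κ, aDiag (fibreAl N (ofRealVec q) (LAl_ofRealVec_ne_zero hN hq hq0)) κ ≠ 0)
      ∧ sigma (fibreAl N (ofRealVec q) (LAl_ofRealVec_ne_zero hN hq hq0)) ≠ 0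
      ∧ hSum (aDiag (fibreAl N (ofRealVec q) (LAl_ofRealVec_ne_zero hN hq hq0))) (dhat (ofRealVec q)) (dflat (ofRealVec q)) ≠ 0 :=
  nonvanishing _ hN hq hq0 (fun κ => CapacitanceScalarDictionary.aDiag_fibreAl q _ κ) (CapacitanceScalarDictionary.sigma_fibreAl q _)

/-- **`cap N p` IS INVERTIBLE at every real `p = ofRealVec q`, `q ∈ [−π, π]^D ∖ {0}`, every `N ≥ 1`** — UNCONDITIONALLY (leaf-02's `isUnit_cap` with the
three non-vanishings discharged; no determinant of the Bloch fibre matrix). [folklore] -/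
theorem isUnit_cap_ofRealVec (hN : 1 ≤ N) (hq : ∀ i, |q i| ≤ π) (hq0 : q ≠ 0) : IsUnit (cap N (ofRealVec q)) := by
  obtain ⟨ha, hσ, hh⟩ := nonvanishing_fibreAl hN hq hq0
  exact CapacitanceClosedFormAlias.isUnit_cap N (ofRealVec q) _ ha hσ hh

/-- [folklore] … hence T00's `hdet` binder: `IsUnit (cap N (ofRealVec q)).det`. -/
theorem isUnit_cap_det_ofRealVec (hN : 1 ≤ N) (hq : ∀ i, |q i| ≤ π) (hq0 : q ≠ 0) : IsUnit (cap N (ofRealVec q)).det :=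
  (Matrix.isUnit_iff_isUnit_det _).mp (isUnit_cap_ofRealVec hN hq hq0)

/-- **A4 `cap_lower`, `φφ` BLOCK OF `(cap N p)⁻¹`**: `‖(cap N p)⁻¹ (inl κ) (inl l)‖ ≤ cPP D · |q|²/N^{D+4}` for every `N ≥ 1` and every
`q ∈ [−π, π]^D ∖ {0}` (`p = ofRealVec q`) — `SKELETON-P1.md` A4′(iii) `(Cap⁻¹)_φφ = O(|p|²/N^{D+4})`, N-uniform. [folklore] -/
theorem norm_cap_inv_inl_inl_le (hN : 1 ≤ N) (hq : ∀ i, |q i| ≤ π) (hq0 : q ≠ 0) (κ l : Fin D) :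
    ‖(cap N (ofRealVec q))⁻¹ (Sum.inl κ) (Sum.inl l)‖ ≤ cPP D * momSq q / (N : ℝ) ^ (D + 4) := by
  obtain ⟨ha, hσ, hh⟩ := nonvanishing_fibreAl hN hq hq0
  rw [CapacitanceClosedFormAlias.cap_inv_inl_inl N (ofRealVec q) _ ha hσ hh, aDiag_fibreAl_eq hN hq hq0]
  exact norm_invPP_le hN hq hq0 κ l

/-- **`φc` COLUMN OF `(cap N p)⁻¹`**: `‖(cap N p)⁻¹ (inl κ) (inr u)‖ ≤ cPc D · |q|²√|q|²/N^{D+4}` (`= O(|p|³/N^{D+4})`), N-uniform. [folklore] -/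
theorem norm_cap_inv_inl_inr_le (hN : 1 ≤ N) (hq : ∀ i, |q i| ≤ π) (hq0 : q ≠ 0) (κ : Fin D) (u : Unit) :
    ‖(cap N (ofRealVec q))⁻¹ (Sum.inl κ) (Sum.inr u)‖ ≤ cPc D * (momSq q * Real.sqrt (momSq q)) / (N : ℝ) ^ (D + 4) := by
  obtain ⟨ha, hσ, hh⟩ := nonvanishing_fibreAl hN hq hq0
  rw [CapacitanceClosedFormAlias.cap_inv_inl_inr N (ofRealVec q) _ ha hσ hh κ u, aDiag_fibreAl_eq hN hq hq0,
    CapacitanceScalarDictionary.sigma_fibreAl q]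
  exact norm_invPc_le hN hq hq0 κ

/-- **`cφ` ROW OF `(cap N p)⁻¹`**: `‖(cap N p)⁻¹ (inr u) (inl l)‖ ≤ cPc D · |q|²√|q|²/N^{D+4}`, N-uniform. [folklore] -/
theorem norm_cap_inv_inr_inl_le (hN : 1 ≤ N) (hq : ∀ i, |q i| ≤ π) (hq0 : q ≠ 0) (u : Unit) (l : Fin D) :
    ‖(cap N (ofRealVec q))⁻¹ (Sum.inr u) (Sum.inl l)‖ ≤ cPc D * (momSq q * Real.sqrt (momSq q)) / (N : ℝ) ^ (D + 4) := by
  obtain ⟨ha, hσ, hh⟩ := nonvanishing_fibreAl hN hq hq0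
  rw [CapacitanceClosedFormAlias.cap_inv_inr_inl N (ofRealVec q) _ ha hσ hh u l, aDiag_fibreAl_eq hN hq hq0,
    CapacitanceScalarDictionary.sigma_fibreAl q]
  exact norm_invcP_le hN hq hq0 l

/-- **`cc` CORNER OF `(cap N p)⁻¹`** (no cancellation): `‖(cap N p)⁻¹ (inr u) (inr u')‖ ≤ ccc D · |q|⁴/N^{D+4}`, N-uniform (the finer `|p|⁶`
order of A4′(iii) is typer row P1-Y08cc, not used here). [folklore] -/
theorem norm_cap_inv_inr_inr_le (hN : 1 ≤ N) (hq : ∀ i, |q i| ≤ π) (hq0 : q ≠ 0) (u u' : Unit) :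
    ‖(cap N (ofRealVec q))⁻¹ (Sum.inr u) (Sum.inr u')‖ ≤ ccc D * momSq q ^ 2 / (N : ℝ) ^ (D + 4) := by
  obtain ⟨ha, hσ, hh⟩ := nonvanishing_fibreAl hN hq hq0
  rw [CapacitanceClosedFormAlias.cap_inv_inr_inr N (ofRealVec q) _ ha hσ hh u u', aDiag_fibreAl_eq hN hq hq0,
    CapacitanceScalarDictionary.sigma_fibreAl q]
  exact norm_invcc_le hN hq hq0

/-- **T00's CLOSED-FORM PAIR `(phiSol, cSol)` SOLVES THE CAPACITANCE SYSTEM at every real `q ≠ 0`, `N ≥ 1`** (T00's `capSolves_closed` with its `hdet`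
binder discharged). [folklore] -/
theorem capSolves_phiSol_cSol (hN : 1 ≤ N) (hq : ∀ i, |q i| ≤ π) (hq0 : q ≠ 0) (fhat : TorusSite D N → Fin D → ℂ) (chat : Fin D → ℂ) :
    CapSolves (fibreAl N (ofRealVec q) (LAl_ofRealVec_ne_zero hN hq hq0)) fhat 0 0 chat
      (phiSol N (ofRealVec q) fhat chat) (cSol N (ofRealVec q) fhat chat) :=
  AliasObjects.capSolves_closed N (ofRealVec q) _ (isUnit_cap_det_ofRealVec hN hq hq0) fhat chat

/-- **T00's CLOSED-FORM PER-FIBRE SOLVE `(Ahat, muhat, phiSol, cSol)` SOLVES THE ARROW SYSTEM at every real `q ≠ 0`, `N ≥ 1`** (sources `(f̂, 0, 0, ĉ)`;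
T00's `arrowSolves_closed` with `hdet` discharged). [folklore] -/
theorem arrowSolves_ofRealVec (hN : 1 ≤ N) (hq : ∀ i, |q i| ≤ π) (hq0 : q ≠ 0) (fhat : TorusSite D N → Fin D → ℂ) (chat : Fin D → ℂ) :
    ArrowSolves (fibreAl N (ofRealVec q) (LAl_ofRealVec_ne_zero hN hq hq0)) fhat 0 0 chat
      (Ahat N (ofRealVec q) fhat chat) (muhat N (ofRealVec q) fhat chat) (phiSol N (ofRealVec q) fhat chat) (cSol N (ofRealVec q) fhat chat) :=
  AliasObjects.arrowSolves_closed N (ofRealVec q) _ (isUnit_cap_det_ofRealVec hN hq hq0) fhat chat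

/-- **N-UNIFORM BOUND OF T00's CONSTRAINT MULTIPLIERS `phiSol`** [folklore]:
`‖phiSol κ‖ ≤ cPP·|q|²/N^{D+4} · Σ_l ‖r_φ l‖ + cPc·|q|²√|q|²/N^{D+4} · ‖r_c‖` (`r_φ = srcPhi`, `r_c = srcC`). -/
theorem norm_phiSol_le (hN : 1 ≤ N) (hq : ∀ i, |q i| ≤ π) (hq0 : q ≠ 0) (fhat : TorusSite D N → Fin D → ℂ) (chat : Fin D → ℂ) (κ : Fin D) :
    ‖phiSol N (ofRealVec q) fhat chat κ‖
      ≤ cPP D * momSq q / (N : ℝ) ^ (D + 4) * ∑ l, ‖srcPhi N (ofRealVec q) fhat chat l‖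
        + cPc D * (momSq q * Real.sqrt (momSq q)) / (N : ℝ) ^ (D + 4) * ‖srcC N (ofRealVec q) fhat‖ := by
  obtain ⟨ha, hσ, hh⟩ := nonvanishing_fibreAl hN hq hq0
  rw [CapacitanceClosedFormAlias.phiSol_eq N (ofRealVec q) _ ha hσ hh, aDiag_fibreAl_eq hN hq hq0,
    CapacitanceScalarDictionary.sigma_fibreAl q]
  exact norm_phiCF_le hN hq hq0 _ _ κ

/-- **N-UNIFORM BOUND OF T00's BLOCK GAUGE CONSTANT `cSol`** [folklore] (no cancellation):
`‖cSol‖ ≤ cPc·|q|²√|q|²/N^{D+4} · Σ_l ‖r_φ l‖ + ccc·|q|⁴/N^{D+4} · ‖r_c‖`. -/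
theorem norm_cSol_le (hN : 1 ≤ N) (hq : ∀ i, |q i| ≤ π) (hq0 : q ≠ 0) (fhat : TorusSite D N → Fin D → ℂ) (chat : Fin D → ℂ) :
    ‖cSol N (ofRealVec q) fhat chat‖
      ≤ cPc D * (momSq q * Real.sqrt (momSq q)) / (N : ℝ) ^ (D + 4) * ∑ l, ‖srcPhi N (ofRealVec q) fhat chat l‖
        + ccc D * momSq q ^ 2 / (N : ℝ) ^ (D + 4) * ‖srcC N (ofRealVec q) fhat‖ := by
  obtain ⟨ha, hσ, hh⟩ := nonvanishing_fibreAl hN hq hq0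
  rw [CapacitanceClosedFormAlias.cSol_eq N (ofRealVec q) _ ha hσ hh, aDiag_fibreAl_eq hN hq hq0,
    CapacitanceScalarDictionary.sigma_fibreAl q]
  exact norm_cCF_le hN hq hq0 _ _

end endpoint

end Summit.QuantumFields.BalabanUV.Beta.GAN24.CapacitanceEndpoint

end
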